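import Mathlib
import HarnessLib
import Summits.CriticalPhenomena.PercolationContinuityZ3.Theses.PercLowPointHalfSpace

/-!
# Crux `LowPointBookkeeping` (stmt-CriticalPhenomena-14713), line `SketchIdeator4`: stub `stub_composition`

Helper file for the crux item `stmt-CriticalPhenomena-14713` (`LowPointBookkeeping`, K) of route
`CriticalPhenomena/PercLowPointHalfSpace` (lands `--supports stmt-CriticalPhenomena-14713`, registered
stub `stub_composition` of the skeleton `stem-criterion`, line `SketchIdeator4`, lead a1).

This is the pure real-analysis end of the stem criterion for `θ(p_c(ℤ³)) = 0`.  Write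
`θ = θ(p_c)`, `F(R) = Σ_{x ∈ B_{4R}} P(0 ↔_ℍ x, arm_R)` (fat mass), `T(R) = Σ_{x ∈ B_{2R}} P(0 ↔_ℍ x,
arm_R, thin stem)` (thin mass), `P(R) = P(arm_R)`.  From

* (SC)        `θ · R ≤ 6 · (R^{-φ} · F(R) + T(R))` for `R ≥ 1` (the dyadic stem criterion),
* (Bwide)     `F(R) ≤ C · R^{11/4} · P(R)` for `R ≥ 1`,
* (QuantC a)  `P(R) ≤ C' · R^{-a}` for `R ≥ 1`,
* (StemLight) `R⁻¹ · T(R) → 0`,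

and `7/4 < a + φ` one gets `θ ≤ 6 C C' R^{7/4 - a - φ} + 6 R⁻¹ T(R) → 0`, so `θ ≤ 0 ≤ θ`.

* `StemCriterion.Composition.const_eq_zero_of_bound`: the abstract statement with arbitrary
  `F T P : ℕ → ℝ` (`P ≥ 0`) and a real `θ ≥ 0`;
* `StemCriterion.stub_composition`: the registered stub, by instantiation.
-/

noncomputable section

open MeasureTheory Filter Topology
open Literature.Probability.Percolation Literature.Probability.LatticeModels
open scoped ENNReal Classical

namespace Summit.CriticalPhenomena.PercolationContinuityZ3.Theorems.StemCriterion

open Summit.CriticalPhenomena.PercolationContinuityZ3.Theses.PercLowPointHalfSpace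

namespace Composition

/-- Merging the powers: for `r > 0`, `r⁻¹ · r^{-φ} · r^{11/4} · r^{-a} = r^{-(a + φ - 7/4)}`. -/
theorem rpow_merge {r : ℝ} (hr : 0 < r) (a φ : ℝ) :
    r⁻¹ * r ^ (-φ) * r ^ ((11 : ℝ) / 4) * r ^ (-a) = r ^ (-(a + φ - 7 / 4)) := by
  rw [← Real.rpow_neg_one, ← Real.rpow_add hr, ← Real.rpow_add hr, ← Real.rpow_add hr]
  congr 1
  ring

/-- The decaying power along `ℕ`: `(R : ℝ)^{-(a + φ - 7/4)} → 0` when `7/4 < a + φ`. -/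
theorem tendsto_rpow_natCast {a φ : ℝ} (haφ : (7 : ℝ) / 4 < a + φ) :
    Tendsto (fun R : ℕ => (R : ℝ) ^ (-(a + φ - 7 / 4))) atTop (𝓝 0) :=
  (tendsto_rpow_neg_atTop (by linarith)).comp tendsto_natCast_atTop_atTop

/-- The bound at one scale `R ≥ 1` with nonnegative constants:
`θ ≤ 6 C C' R^{-(a + φ - 7/4)} + 6 R⁻¹ T(R)`. -/
theorem pointwise_bound {θ a φ C C' : ℝ} {F T P : ℕ → ℝ} (hC : 0 ≤ C) {R : ℕ} (hR : 1 ≤ R)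
    (hSC : θ * R ≤ 6 * ((R : ℝ) ^ (-φ) * F R + T R))
    (hB : F R ≤ C * (R : ℝ) ^ ((11 : ℝ) / 4) * P R) (hQ : P R ≤ C' * (R : ℝ) ^ (-a)) :
    θ ≤ 6 * (C * C') * (R : ℝ) ^ (-(a + φ - 7 / 4)) + 6 * ((R : ℝ)⁻¹ * T R) := by
  have hr : (0 : ℝ) < R := by exact_mod_cast hR
  have h1 : θ ≤ (R : ℝ)⁻¹ * (6 * ((R : ℝ) ^ (-φ) * F R + T R)) := by
    rw [← div_eq_inv_mul, le_div_iff₀ hr]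
    exact hSC
  have h2 : (R : ℝ) ^ (-φ) * F R
      ≤ (R : ℝ) ^ (-φ) * (C * (R : ℝ) ^ ((11 : ℝ) / 4) * (C' * (R : ℝ) ^ (-a))) :=
    mul_le_mul_of_nonneg_left
      (hB.trans (mul_le_mul_of_nonneg_left hQ (mul_nonneg hC (Real.rpow_nonneg hr.le _))))
      (Real.rpow_nonneg hr.le _)
  calc θ ≤ (R : ℝ)⁻¹ * (6 * ((R : ℝ) ^ (-φ) * F R + T R)) := h1
    _ ≤ (R : ℝ)⁻¹ * (6 * ((R : ℝ) ^ (-φ) * (C * (R : ℝ) ^ ((11 : ℝ) / 4) * (C' * (R : ℝ) ^ (-a)))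
          + T R)) :=
        mul_le_mul_of_nonneg_left (by linarith) (inv_nonneg.2 hr.le)
    _ = 6 * (C * C') * ((R : ℝ)⁻¹ * (R : ℝ) ^ (-φ) * (R : ℝ) ^ ((11 : ℝ) / 4) * (R : ℝ) ^ (-a))
          + 6 * ((R : ℝ)⁻¹ * T R) := by ring
    _ = 6 * (C * C') * (R : ℝ) ^ (-(a + φ - 7 / 4)) + 6 * ((R : ℝ)⁻¹ * T R) := by
        rw [rpow_merge hr]

/-- **Abstract composition.**  If `θ ≥ 0`, `P ≥ 0`, `7/4 < a + φ`, and for all `R ≥ 1`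
`θ R ≤ 6 (R^{-φ} F(R) + T(R))`, `F(R) ≤ C R^{11/4} P(R)`, `P(R) ≤ C' R^{-a}`, while
`R⁻¹ T(R) → 0`, then `θ = 0`.  (The constants are first replaced by `max C 0`, `max C' 0`.) -/
theorem const_eq_zero_of_bound {θ a φ : ℝ} {F T P : ℕ → ℝ} (hθ : 0 ≤ θ)
    (haφ : (7 : ℝ) / 4 < a + φ) (hP : ∀ R, 0 ≤ P R)
    (hSC : ∀ R : ℕ, 1 ≤ R → θ * R ≤ 6 * ((R : ℝ) ^ (-φ) * F R + T R))
    (hB : ∃ C : ℝ, ∀ R : ℕ, 1 ≤ R → F R ≤ C * (R : ℝ) ^ ((11 : ℝ) / 4) * P R)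
    (hQ : ∃ C : ℝ, ∀ R : ℕ, 1 ≤ R → P R ≤ C * (R : ℝ) ^ (-a))
    (hS : Tendsto (fun R : ℕ => (R : ℝ)⁻¹ * T R) atTop (𝓝 0)) : θ = 0 := by
  obtain ⟨C, hC⟩ := hB
  obtain ⟨C', hC'⟩ := hQ
  have hB' : ∀ R : ℕ, 1 ≤ R → F R ≤ max C 0 * (R : ℝ) ^ ((11 : ℝ) / 4) * P R := fun R hR =>
    (hC R hR).trans (by
      rw [mul_assoc, mul_assoc]
      exact mul_le_mul_of_nonneg_right (le_max_left _ _)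
        (mul_nonneg (Real.rpow_nonneg (Nat.cast_nonneg _) _) (hP R)))
  have hQ' : ∀ R : ℕ, 1 ≤ R → P R ≤ max C' 0 * (R : ℝ) ^ (-a) := fun R hR =>
    (hC' R hR).trans
      (mul_le_mul_of_nonneg_right (le_max_left _ _) (Real.rpow_nonneg (Nat.cast_nonneg _) _))
  have hlim : Tendsto (fun R : ℕ => 6 * (max C 0 * max C' 0) * (R : ℝ) ^ (-(a + φ - 7 / 4))
      + 6 * ((R : ℝ)⁻¹ * T R)) atTop (𝓝 0) := by
    have h := ((tendsto_rpow_natCast haφ).const_mul (6 * (max C 0 * max C' 0))).add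
      (hS.const_mul 6)
    simp only [mul_zero, add_zero] at h
    exact h
  have hle : θ ≤ 0 :=
    ge_of_tendsto hlim (Filter.eventually_atTop.2 ⟨1, fun R hR =>
      pointwise_bound (le_max_right _ _) hR (hSC R hR) (hB' R hR) (hQ' R hR)⟩)
  exact le_antisymm hle hθ

end Composition

/-- **stub_composition** (real analysis): the dyadic stem criterion at depth `φ`, `Bwide` (B on the 4×-ball),
`QuantC a` (C with the named exponent `a`) and `StemLight φ` (thin-stemmed tall wall clusters carry vanishing
level density) give `θ(p_c) ≤ 6·C·C'·R^{7/4-a-φ} + 6·R⁻¹·S_φ(R) → 0` when `a + φ > 7/4`. -/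
theorem stub_composition : ∀ a φ : ℝ, 0 ≤ φ → (7 : ℝ) / 4 < a + φ → (∀ R : ℕ, 1 ≤ R → theta (zdGraph 3) (0 : Site 3) (criticalProbI 3) * R ≤ 6 * ((R : ℝ) ^ (-φ) * ∑ x ∈ box 3 (4 * R), (bondPercolation (zdGraph 3) (criticalProbI 3)).real (openConnIn {x : Site 3 | 0 ≤ x 0} 0 x ∩ {ω | ∃ y : Site 3, (∃ i : Fin 3, (R : ℤ) ≤ |y i|) ∧ ω ∈ openConnIn {x : Site 3 | 0 ≤ x 0} 0 y}) + ∑ x ∈ box 3 (2 * R), (bondPercolation (zdGraph 3) (criticalProbI 3)).real (openConnIn {x : Site 3 | 0 ≤ x 0} 0 x ∩ {ω | ∃ y : Site 3, (∃ i : Fin 3, (R : ℤ) ≤ |y i|) ∧ ω ∈ openConnIn {x : Site 3 | 0 ≤ x 0} 0 y} ∩ {ω | ((((box 3 R).filter fun g : Site 3 => g 0 = 0 ∧ ω ∈ openConnIn ((↑(box 3 R) : Set (Site 3)) ∩ {x : Site 3 | 0 ≤ x 0}) 0 g).card : ℕ) : ℝ) < (2 * (R : ℝ)) ^ φ}))) →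 (∃ C : ℝ, ∀ r : ℕ, 1 ≤ r → ∑ x ∈ box 3 (4 * r), (bondPercolation (zdGraph 3) (criticalProbI 3)).real (openConnIn {x : Site 3 | 0 ≤ x 0} 0 x ∩ {ω | ∃ y : Site 3, (∃ i : Fin 3, (r : ℤ) ≤ |y i|) ∧ ω ∈ openConnIn {x : Site 3 | 0 ≤ x 0} 0 y}) ≤ C * (r : ℝ) ^ ((11 : ℝ) / 4) * (bondPercolation (zdGraph 3) (criticalProbI 3)).real {ω | ∃ y : Site 3, (∃ i : Fin 3, (r : ℤ) ≤ |y i|) ∧ ω ∈ openConnIn {x : Site 3 | 0 ≤ x 0} 0 y}) → (∃ C : ℝ, ∀ r : ℕ, 1 ≤ r → (bondPercolation (zdGraph 3) (criticalProbI 3)).real {ω | ∃ y : Site 3, (∃ i : Fin 3, (r : ℤ) ≤ |y i|) ∧ ω ∈ openConnIn {x : Site 3 | 0 ≤ x 0} 0 y} ≤ C * (r : ℝ) ^ (-a)) → Tendsto (fun R : ℕ => (R : ℝ)⁻¹ * ∑ x ∈ box 3 (2 * R), (bondPercolation (zdGraph 3) (criticalProbI 3)).real (openConnIn {x : Site 3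 | 0 ≤ x 0} 0 x ∩ {ω | ∃ y : Site 3, (∃ i : Fin 3, (R : ℤ) ≤ |y i|) ∧ ω ∈ openConnIn {x : Site 3 | 0 ≤ x 0} 0 y} ∩ {ω | ((((box 3 R).filter fun g : Site 3 => g 0 = 0 ∧ ω ∈ openConnIn ((↑(box 3 R) : Set (Site 3)) ∩ {x : Site 3 | 0 ≤ x 0}) 0 g).card : ℕ) : ℝ) < (2 * (R : ℝ)) ^ φ})) atTop (𝓝 0) → theta (zdGraph 3) (0 : Site 3) (criticalProbI 3) = 0 := by
  intro a φ _ haφ hSC hB hQ hS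
  exact Composition.const_eq_zero_of_bound (by unfold theta; exact measureReal_nonneg) haφ
    (fun _ => measureReal_nonneg) hSC hB hQ hS

end Summit.CriticalPhenomena.PercolationContinuityZ3.Theorems.StemCriterion

end
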